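import Literature.AnabelianGeometry.AbsoluteAnabelian.MLFGaloisTLGUnitsFunctor
import Literature.AnabelianGeometry.AbsoluteAnabelian.MLFGaloisIntegersFunctor
import Literature.AnabelianGeometry.AbsoluteAnabelian.MonoidKummerMapsIdRigidProofs

/-!
# Compatibility of the natural functors of [AbsTopIII] Def 3.1 (iii): `TM → TLG → TCG ≅ TM → TCG`

S. Mochizuki, *Topics in absolute anabelian geometry III*, §3, Def. 3.1 (iii) p. 68 (bib key
`MochizukiAbsTopIII2015`; lit key `paper:url-5493eb38cbb7`): the four "natural functors"
`𝒞^MLF_TF → 𝒞^MLF_TM → 𝒞^MLF_TLG → 𝒞^MLF_TCG`, `𝒞^MLF_TM → 𝒞^MLF_TCG` are the formations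
`k̄ ↦ 𝒪_k̄^⊳ ↦ k̄^× ↦ 𝒪_k̄^×` and `𝒪_k̄^⊳ ↦ 𝒪_k̄^×`, so the triangle `TM → TLG → TCG` / `TM → TCG` commutes (both
composites are `(Π ↷ 𝒪_k̄^⊳) ↦ (Π ↷ 𝒪_k̄^×)`).  On ABSTRACT pairs the two routes are built differently — the
units `M^×` of the monoid (`MLFGaloisUnitsFunctors`, seat abc-iut-L4-t2 gen 3) versus the INTRINSIC units of
the group `M^gp` read through Rmk. 3.1.1 (`MLFGaloisTLGUnits`, gen 4) — and this file (seat abc-iut-L4-t2)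
proves that they agree, canonically and naturally:

* `GaloisMonoidPair.isIntrinsicUnit_of_unit` — for an MLF-Galois `TM`-pair `(Π ↷ M)` and a unit `u ∈ M^×`,
  `u/1 ∈ M^gp` is an intrinsic unit of `(Π ↷ M^gp)`; `exists_unit_of_isIntrinsicUnit` — conversely every
  intrinsic unit of `M^gp` is `u/1` for a (unique) `u ∈ M^×`;
* `GaloisMonoidPair.unitsIsoTLGUnits hP : (Π ↷ M^×) ⥲ (Π ↷ 𝒪^×(M^gp))` — the CANONICAL isomorphism of
  pairs `u ↦ u/1` (identity on `Π`);
* the restricted functors `tmToTLGCompact`, `tfToTMCompact`, `MLFGaloisMonoidPairCompactCat.forget` (the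
  Galois group is unchanged, so compactness is preserved and the chain `TF → TM → TLG → TCG` composes on
  pairs with compact Galois group), and the natural isomorphism
  `tmToTLG_tlgToTCG_iso : tmToTLGCompact ⋙ tlgToTCG ≅ forget ⋙ tmToTCG`.

HONEST FRAMING: a consistency check between OUR kernel constructions; nothing here bears on [IUTchIII]
Cor. 3.12; typed ≠ proved for anything downstream.
-/

noncomputable section

universe u

namespace Literature.AnabelianGeometry.AbsoluteAnabelian

open _root_.CategoryTheory Algebra
open _root_.ValuativeRel
open Literature.NumberTheory.GaloisRepresentations
open Literature.AlgebraicGeometry.Frobenioids (gpMap gpMap_of)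
open scoped nonZeroDivisors

attribute [local instance] Literature.AnabelianGeometry.EtaleTheta.grothendieckGroupAction
  unitsMulDistribMulAction

/-! ### The model computation: `f : (Π_k ↷ k̄^×) ⥲ (Π ↷ M^gp)` sends `m ∈ 𝒪_k̄^⊳` to `e(m)/1` -/

namespace ModelMLFGaloisData

variable (C : MLFClosure.{u}) (D : ModelMLFGaloisData C.k C.K) {P : GaloisMonoidPair.{u}}

/-- The isomorphism `(Π_k ↷ k̄^×) ⥲ (Π ↷ M^gp)` induced by a model `(Π_k ↷ 𝒪_k̄^⊳) ⥲ (Π ↷ M)`: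
`(𝒪_k̄^⊳)^gp = k̄^×` followed by `(e_M)^gp`. [cite: MochizukiAbsTopIII2015, Definition 3.1 (iii) p.68] -/
def tlgIsoGroupification (e : GaloisMonoidPair.Iso D.tmPair P) :
    GaloisMonoidPair.Iso D.tlgPair P.groupification :=
  (gpIsoTLG C D).symm.trans e.groupification

/-- `tlgIsoGroupification e` sends `m ∈ 𝒪_k̄^⊳ ⊆ k̄^×` to `e(m)/1 ∈ M^gp`.
[cite: MochizukiAbsTopIII2015, Definition 3.1 (iii) p.68] -/
theorem tlgIsoGroupification_apply_coe (e : GaloisMonoidPair.Iso D.tmPair P) (m : nonzeroIntegers C.k C.K) :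
    (tlgIsoGroupification C D e).isoM ⟨(m : C.K), mem_nonZeroDivisors_of_ne_zero m.2.2⟩ =
      GrothendieckGroup.of (e.isoM m) := by
  have h1 : (gpEquivNonZeroDivisors C) (GrothendieckGroup.of m) =
      ⟨(m : C.K), mem_nonZeroDivisors_of_ne_zero m.2.2⟩ :=
    Subtype.ext (gpToNonZeroDivisors_of m)
  have h2 : (gpEquivNonZeroDivisors C).symm ⟨(m : C.K), mem_nonZeroDivisors_of_ne_zero m.2.2⟩ =
      GrothendieckGroup.of m := (MulEquiv.symm_apply_eq _).mpr h1.symm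
  change gpMap e.isoM.toMonoidHom ((gpEquivNonZeroDivisors C).symm _) = _
  rw [h2, gpMap_of]
  rfl

end ModelMLFGaloisData

/-! ### `u ↦ u/1` identifies the units of `M` with the intrinsic units of `M^gp` -/

namespace GaloisMonoidPair

variable {P Q : GaloisMonoidPair.{u}}

/-- **For an MLF-Galois `TM`-pair, `u/1 ∈ M^gp` is an intrinsic unit for every unit `u ∈ M^×`** (on the
model: `u ∈ 𝒪_k̄^×`, and the intrinsic units of `k̄^×` are `𝒪_k̄^×`, `isIntrinsicUnit_tlgPair_iff`).
[cite: MochizukiAbsTopIII2015, Definition 3.1 (iii) p.68] -/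
theorem isIntrinsicUnit_of_unit (hP : IsMLFGaloisMonoidPair .TM P) (u : P.Mˣ) :
    P.groupification.IsIntrinsicUnit (GrothendieckGroup.of (u : P.M)) := by
  obtain ⟨C, D, Q₀, hQ₀, ⟨e⟩⟩ := hP.exists_model
  have hQ' : D.tmPair = Q₀ := Option.some_injective _ (D.monoidPair_TM.symm.trans hQ₀)
  subst hQ'
  set m₀ : (nonzeroIntegers C.k C.K)ˣ := Units.map e.isoM.symm.toMonoidHom u with hm₀
  have hu : e.isoM (m₀ : nonzeroIntegers C.k C.K) = (u : P.M) := e.isoM.apply_symm_apply _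
  have hmem : ((m₀ : nonzeroIntegers C.k C.K) : C.K) ∈ unitSubmonoid C.k C.K :=
    (ModelMLFGaloisData.unitsEquivUnitSubmonoid C m₀).2
  have h1 : D.tlgPair.IsIntrinsicUnit
      ⟨((m₀ : nonzeroIntegers C.k C.K) : C.K), mem_nonZeroDivisors_of_ne_zero (m₀ : nonzeroIntegers C.k C.K).2.2⟩ :=
    (D.isIntrinsicUnit_tlgPair_iff C _).mpr hmem
  have h2 := (isIntrinsicUnit_iff_of_iso (ModelMLFGaloisData.tlgIsoGroupification C D e) _).mp h1
  rwa [ModelMLFGaloisData.tlgIsoGroupification_apply_coe, hu] at h2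

/-- **Conversely, every intrinsic unit of `M^gp` is `u/1` for a unit `u ∈ M^×`** (on the model: an element
of `𝒪_k̄^× ⊆ 𝒪_k̄^⊳`, invertible in the monoid `𝒪_k̄^⊳`). [cite: MochizukiAbsTopIII2015, Definition 3.1 (iii) p.68] -/
theorem exists_unit_of_isIntrinsicUnit (hP : IsMLFGaloisMonoidPair .TM P) {y : P.groupification.M}
    (hy : P.groupification.IsIntrinsicUnit y) : ∃ u : P.Mˣ, GrothendieckGroup.of (u : P.M) = y := by
  obtain ⟨C, D, Q₀, hQ₀, ⟨e⟩⟩ := hP.exists_model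
  have hQ' : D.tmPair = Q₀ := Option.some_injective _ (D.monoidPair_TM.symm.trans hQ₀)
  subst hQ'
  set f := ModelMLFGaloisData.tlgIsoGroupification C D e with hf
  set z : D.tlgPair.M := f.isoM.symm y with hz
  have hz' : D.tlgPair.IsIntrinsicUnit z := by
    have := (isIntrinsicUnit_iff_of_iso f.symm y).mp hy
    exact this
  have hzu : (z : C.K) ∈ unitSubmonoid C.k C.K := (D.isIntrinsicUnit_tlgPair_iff C z).mp hz'
  set m₀ : (nonzeroIntegers C.k C.K)ˣ := (ModelMLFGaloisData.unitsEquivUnitSubmonoid C).symm ⟨(z : C.K), hzu⟩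
    with hm₀
  have hm₀val : ((m₀ : nonzeroIntegers C.k C.K) : C.K) = (z : C.K) := by
    have h := ModelMLFGaloisData.coe_unitsEquivUnitSubmonoid C m₀
    rw [hm₀, MulEquiv.apply_symm_apply] at h
    exact h.symm
  refine ⟨Units.map e.isoM.toMonoidHom m₀, ?_⟩
  have hz0 : (⟨((m₀ : nonzeroIntegers C.k C.K) : C.K),
      mem_nonZeroDivisors_of_ne_zero (m₀ : nonzeroIntegers C.k C.K).2.2⟩ : D.tlgPair.M) = z :=
    Subtype.ext hm₀val
  have h1 := ModelMLFGaloisData.tlgIsoGroupification_apply_coe C D e (m₀ : nonzeroIntegers C.k C.K)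
  rw [hz0, ← hf, hz, MulEquiv.apply_symm_apply] at h1
  exact h1.symm

/-- The canonical map `M^× → 𝒪^×(M^gp)`, `u ↦ u/1`, as a monoid homomorphism into the intrinsic units of
`(Π ↷ M^gp)`. [cite: MochizukiAbsTopIII2015, Definition 3.1 (iii) p.68] -/
def unitsToTLGUnits (hP : IsMLFGaloisMonoidPair .TM P) :
    P.Mˣ →* (P.groupification.tlgUnitsPair (isMLFGaloisMonoidPair_TLG_groupification hP)).M where
  toFun u := ⟨GrothendieckGroup.of (u : P.M), isIntrinsicUnit_of_unit hP u⟩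
  map_one' := Subtype.ext (by
    change GrothendieckGroup.of ((1 : P.Mˣ) : P.M) = 1
    rw [Units.val_one, map_one])
  map_mul' u v := Subtype.ext (by
    change GrothendieckGroup.of ((u * v : P.Mˣ) : P.M) =
      GrothendieckGroup.of (u : P.M) * GrothendieckGroup.of (v : P.M)
    rw [Units.val_mul, map_mul])

/-- `unitsToTLGUnits` on underlying elements. [cite: MochizukiAbsTopIII2015, Definition 3.1 (iii) p.68] -/
@[simp] theorem unitsToTLGUnits_coe (hP : IsMLFGaloisMonoidPair .TM P) (u : P.Mˣ) :
    ((unitsToTLGUnits hP u : (P.groupification.tlgUnitsPair _).M) : P.groupification.M) =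
      GrothendieckGroup.of (u : P.M) := rfl

/-- `u ↦ u/1 : M^× → 𝒪^×(M^gp)` is bijective (`M ↪ M^gp` for cancellative `M`; surjectivity by
`exists_unit_of_isIntrinsicUnit`). [cite: MochizukiAbsTopIII2015, Definition 3.1 (iii) p.68] -/
theorem unitsToTLGUnits_bijective (hP : IsMLFGaloisMonoidPair .TM P) :
    Function.Bijective (unitsToTLGUnits hP) := by
  constructor
  · intro u v h
    have h' := congrArg (fun w : (P.groupification.tlgUnitsPair _).M => (w : P.groupification.M)) h
    exact Units.ext (of_injective_of_TM hP h')
  · rintro ⟨y, hy⟩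
    obtain ⟨u, hu⟩ := exists_unit_of_isIntrinsicUnit hP hy
    exact ⟨u, Subtype.ext hu⟩

/-- **The canonical isomorphism of pairs `(Π ↷ M^×) ⥲ (Π ↷ 𝒪^×(M^gp))`** for an MLF-Galois `TM`-pair:
identity on `Π`, `u ↦ u/1` on the arithmetic data (equivariant: `(g • u)/1 = g • (u/1)`).  This is the
agreement `TM → TCG = TM → TLG → TCG` of the natural functors of Def 3.1 (iii) at the object `(Π ↷ M)`.
[cite: MochizukiAbsTopIII2015, Definition 3.1 (iii) p.68] -/
def unitsIsoTLGUnits (hP : IsMLFGaloisMonoidPair .TM P) :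
    GaloisMonoidPair.Iso P.unitsPair
      (P.groupification.tlgUnitsPair (isMLFGaloisMonoidPair_TLG_groupification hP)) where
  isoPi := ContinuousMulEquiv.refl P.Pi
  isoM := MulEquiv.ofBijective (unitsToTLGUnits hP) (unitsToTLGUnits_bijective hP)
  smul_comm g u := Subtype.ext (by
    change GrothendieckGroup.of
        (Units.val (HSMul.hSMul (α := P.unitsPair.Pi) (β := P.unitsPair.M) g u)) =
      HSMul.hSMul (α := P.groupification.Pi) (β := P.groupification.M) g
        (GrothendieckGroup.of (Units.val (show P.Mˣ from u)))
    rw [P.unitsPair_smul_eq, units_val_smul, P.groupification_smul_eq, EtaleTheta.smul_of])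

/-- The Galois component of `unitsIsoTLGUnits` is the identity. [cite: MochizukiAbsTopIII2015, Definition 3.1 (iii) p.68] -/
@[simp] theorem unitsIsoTLGUnits_isoPi_apply (hP : IsMLFGaloisMonoidPair .TM P) (g : P.Pi) :
    (unitsIsoTLGUnits hP).isoPi g = g := rfl

/-- The arithmetic component of `unitsIsoTLGUnits` is `u ↦ u/1`. [cite: MochizukiAbsTopIII2015, Definition 3.1 (iii) p.68] -/
@[simp] theorem unitsIsoTLGUnits_isoM_coe (hP : IsMLFGaloisMonoidPair .TM P) (u : P.Mˣ) :
    (((unitsIsoTLGUnits hP).isoM u : (P.groupification.tlgUnitsPair _).M) : P.groupification.M) =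
      GrothendieckGroup.of (u : P.M) := rfl

end GaloisMonoidPair

/-! ### The functors restricted to compact Galois groups, and the natural isomorphism -/

/-- Forgetting compactness: `MLFGaloisMonoidPairCompactCat T ⥤ 𝒞^MLF_T`. [cite: MochizukiAbsTopIII2015, Definition 3.1 (iii) p.67] -/
def MLFGaloisMonoidPairCompactCat.forget (T : PairType) :
    MLFGaloisMonoidPairCompactCat.{u} T ⥤ MLFGaloisMonoidPairCat.{u} T where
  obj P := ⟨P.obj, P.property.1⟩
  map φ := InducedCategory.homMk φ.hom

/-- `𝒞_TM → 𝒞_TLG` restricted to pairs with compact Galois group (the Galois group is unchanged, so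
compactness is preserved). [cite: MochizukiAbsTopIII2015, Definition 3.1 (iii) p.68] -/
def tmToTLGCompact : MLFGaloisMonoidPairCompactCat.{u} .TM ⥤ MLFGaloisMonoidPairCompactCat.{u} .TLG where
  obj P := ⟨P.obj.groupification,
    GaloisMonoidPair.isMLFGaloisMonoidPair_TLG_groupification P.property.1, P.property.2⟩
  map {P Q} φ := InducedCategory.homMk (GaloisMonoidPair.Hom.groupification (P := P.obj) (Q := Q.obj) φ.hom
    (GaloisMonoidPair.of_injective_of_TM P.property.1) (GaloisMonoidPair.of_injective_of_TM Q.property.1))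
  map_id _ := InducedCategory.Hom.ext (GaloisMonoidPair.Hom.ext rfl
    (Literature.AlgebraicGeometry.Frobenioids.gpMap_id))
  map_comp _ _ := InducedCategory.Hom.ext (GaloisMonoidPair.Hom.ext rfl
    (Literature.AlgebraicGeometry.Frobenioids.gpMap_comp _ _))

/-- `𝒞_TF → 𝒞_TM` with compact target subcategory (so that `TF → TM → TLG → TCG` composes).
[cite: MochizukiAbsTopIII2015, Definition 3.1 (iii) p.68] -/
def tfToTMCompact : MLFGaloisFieldPairCompactCat.{u} ⥤ MLFGaloisMonoidPairCompactCat.{u} .TM where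
  obj P := ⟨P.obj.integersPair P.property.1,
    GaloisFieldPair.isMLFGaloisMonoidPair_TM_integersPair P.property.1, P.property.2⟩
  map {P Q} φ := InducedCategory.homMk
    (GaloisFieldPair.Hom.integers (P := P.obj) (Q := Q.obj) φ.hom P.property.1 Q.property.1
      (fun U hU => by
        haveI := Q.property.2
        exact GaloisFieldPair.Hom.finiteIndex_sat_of_compactSpace (P := P.obj) (Q := Q.obj) φ.hom U hU))
  map_id _ := InducedCategory.Hom.ext (GaloisMonoidPair.Hom.ext rfl (MonoidHom.ext fun _ => Subtype.ext rfl))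
  map_comp _ _ := InducedCategory.Hom.ext (GaloisMonoidPair.Hom.ext rfl (MonoidHom.ext fun _ => Subtype.ext rfl))

/-- `tfToTMCompact` refines `tfToTM`. [cite: MochizukiAbsTopIII2015, Definition 3.1 (iii) p.68] -/
theorem tfToTMCompact_comp_forget :
    tfToTMCompact.{u} ⋙ MLFGaloisMonoidPairCompactCat.forget .TM = tfToTM := rfl

/-- `tmToTLGCompact` refines `tmToTLG`. [cite: MochizukiAbsTopIII2015, Definition 3.1 (iii) p.68] -/
theorem tmToTLGCompact_comp_forget :
    tmToTLGCompact.{u} ⋙ MLFGaloisMonoidPairCompactCat.forget .TLG =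
      MLFGaloisMonoidPairCompactCat.forget .TM ⋙ tmToTLG := rfl

/-- The isomorphism `(Π ↷ M^×) ≅ (Π ↷ 𝒪^×(M^gp))` in the category `𝒞^MLF_TCG`, at an object of the compact
`TM`-subcategory. [cite: MochizukiAbsTopIII2015, Definition 3.1 (iii) p.68] -/
def unitsIsoTLGUnitsCat (P : MLFGaloisMonoidPairCompactCat.{u} .TM) :
    (MLFGaloisMonoidPairCompactCat.forget .TM ⋙ tmToTCG).obj P ≅ (tmToTLGCompact ⋙ tlgToTCG).obj P where
  hom := InducedCategory.homMk (GaloisMonoidPair.unitsIsoTLGUnits P.property.1).toHom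
  inv := InducedCategory.homMk (GaloisMonoidPair.unitsIsoTLGUnits P.property.1).symm'.toHom
  hom_inv_id := InducedCategory.Hom.ext
    (GaloisMonoidPair.Iso.toCatIso (GaloisMonoidPair.unitsIsoTLGUnits P.property.1)).hom_inv_id
  inv_hom_id := InducedCategory.Hom.ext
    (GaloisMonoidPair.Iso.toCatIso (GaloisMonoidPair.unitsIsoTLGUnits P.property.1)).inv_hom_id

/-- **Compatibility of the natural functors of Def 3.1 (iii)**: `TM → TCG ≅ TM → TLG → TCG`, naturally in the
MLF-Galois `TM`-pair (with compact Galois group), via `u ↦ u/1`.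
[cite: MochizukiAbsTopIII2015, Definition 3.1 (iii) p.68] -/
def tmToTLG_tlgToTCG_iso :
    MLFGaloisMonoidPairCompactCat.forget.{u} .TM ⋙ tmToTCG ≅ tmToTLGCompact ⋙ tlgToTCG :=
  NatIso.ofComponents unitsIsoTLGUnitsCat (fun {P Q} φ => by
    refine InducedCategory.Hom.ext (GaloisMonoidPair.Hom.ext rfl (MonoidHom.ext fun u => Subtype.ext ?_))
    change GrothendieckGroup.of ((Units.map (GaloisMonoidPair.Hom.homM (P := P.obj) (Q := Q.obj) φ.hom)
        (show P.obj.Mˣ from u) : Q.obj.Mˣ) : Q.obj.M) =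
      gpMap (GaloisMonoidPair.Hom.homM (P := P.obj) (Q := Q.obj) φ.hom)
        (GrothendieckGroup.of ((show P.obj.Mˣ from u) : P.obj.M))
    rw [gpMap_of]
    rfl)

end Literature.AnabelianGeometry.AbsoluteAnabelian

end
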